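import Mathlib
import Literature.AlgebraicGeometry.HodgeTheory.WeilClassesSixfoldsSplit
import Literature.AlgebraicGeometry.HodgeTheory.WeilClassesFourfoldsFromSixfolds
import Literature.AlgebraicGeometry.HodgeTheory.AbelianLowDimensionWeilReductionProofs
import Literature.AlgebraicGeometry.HodgeTheory.SemiregularVariationalHodgeTwisted
import Literature.AlgebraicGeometry.HodgeTheory.SemiregularityWeakCriterion
import Literature.AlgebraicGeometry.HodgeTheory.WeilClassesLocalAnchor
import Literature.AlgebraicGeometry.HodgeTheory.AlgebraicityLocus
import Literature.AlgebraicGeometry.Motives.WeilDiscriminantSplit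
import HarnessLib

/-!
# Markman 2025 — *secant sheaves and Weil classes*: the printed proof ARCHITECTURE, typed as a DAG of named
# hypothesis nodes over an abstract carrier (statement level; bookkeeping edges proved; no geometry)

CITATION HEADER.  E. Markman: [S] *Secant sheaves and Weil classes on abelian varieties*, arXiv:2509.23403 (v1
2025-09-27; v2 2026-02-11 "Contribution to the ICM 2026", 23 pp.), bib `Markman2025SurveySecant` — an **UNREFEREED
PREPRINT (arXiv, 2025)**; [M] *Cycles on abelian 2n-folds of Weil type from secant sheaves on abelian n-folds*,
arXiv:2502.03415 (v2 2025-06-08, 96 pp.), bib `Markman2025SecantWeil` — **UNREFEREED PREPRINT (arXiv, 2025)**;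
[C] arXiv:2509.23079 (the CM-field companion, typed in `Markman2025/CMFieldCompanion.lean`) — **UNREFEREED PREPRINT
(arXiv, 2025)**; [J] *The monodromy of generalized Kummer varieties …*, J. Eur. Math. Soc. 25 (2023) 231–321 =
arXiv:1805.11574, bib `Markman2023GeneralizedKummers` — REFEREED.  Every `def … : Prop` below transcribes a
statement of [S]/[M] as a HYPOTHESIS SCHEMA over an abstract carrier and carries a `[cite: …]` provenance tag
(transcription) — never a theorem of this library and never claim-tagged (the claims under review are the tree's
REAL-carrier statements in `HodgeTheory/*`, which this file only names); page
numbers are the running heads of the cited arXiv version, "chunk pNNNN" the held corpus text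
(`paper:arxiv-2509.23403`, `paper:arxiv-2502.03415`); the printed-vs-extractor numbering table is the audit cell's
`run/shared/lean/pub/pub-hodgecm/transport/NUMBERING.md`.  HONEST FRAMING: this module is PRE-POSITIONING for a
possible second ring of the `pub-hodgecm` audit (a navigable, kernel-checked map of WHICH printed statement feeds
WHICH); it is not a result, re-proves nothing, and asserts nothing Markman states.  (Lexical note: decl docstrings
write "conj." / HC / VHC; the unabbreviated word is reserved by the gate for Summits-side obligations.)

DESIGN (schematic choices are logged in the cell's DIVERGENCE file).  The tree ALREADY vendors the terminal statements
and the transport mechanism on REAL carriers (`AbelianVariety`, `AbelianFamily`, singular cohomology): Thm 1.2 =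
`HodgeTheory.Markman2025_weilClasses_algebraic_abelianFourfold` / `…_hyperbolicSixfold` (+ `…_abelianSixfold_split_iff`),
Cor 1.3 = `HodgeTheory.Markman2025_hodgeClasses_algebraic_abelian_dim_le_five`, [S] Thm 2.1 =
`HodgeTheory.BuchweitzFlenner2003_variationalHodge_semiregular` (twisted form [M] Conj 7.3.9/§7.4.2, Perry 2026:
`HodgeTheory.Perry2026_semiregularTwisted_remainsAlgebraic`), the linear algebra of [S] Lemma 11.3 / Question 11.4 =
`HodgeTheory.semiregular_of_ker_eq_of_surjective` / `injOn_range_iff_weakCriterion`, the local half of the proof of [M] Thm 1.5.1 =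
`HodgeTheory.Markman2025_secantAnchor_locallyAlgebraic_sixfold`, the "[Vo, Sec. 4.2]" locus =
`HodgeTheory.charlesSchnell_algebraicityLocus_iUnion_closed`, [S] §11.5 Step 1 = `Motives.WeilDiscriminantSplit`,
Step 2 = `HodgeTheory.WeilClassesFourfoldsFromSixfolds`.  Those are NOT restated (the closing `example`s check the names).  This file adds the SPINE of [S] §§2, 4, 11: a `WeilComponent` is an
abstract connected component 𝔐 of the moduli space of polarized abelian `2n`-folds of Weil type deformation
equivalent to the anchor `x₀ = (X × X̂, η, h)`, with the per-member and per-sheaf predicates the printed argument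
manipulates as OPAQUE fields (hypothesis nodes = predicates on the component(s) they name, never quantified
over all abstract carriers; instantiated only by a model, so no `_holds` discharge is expected); the component-level invariants [S] fixes (K imaginary quadratic, `n`, split, discriminant coset) are named
`Prop` fields, never `True` and never silently absorbed.  What the kernel PROVES is exactly the propositional
bookkeeping of [S] §4 ("Conditions (2a) and (2b) and the Semi-regularity theorem imply …"; "Hence every class in
HW(A,η′) is algebraic.") and of [S] §11.5, plus one honest piece of topology: the spreading step of [S] p. 6 (a
countable union of Zariski closed analytic subsets containing a non-empty open subset of a connected base is
everything) is DERIVED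
(`locus_eq_univ_of_baire`) from Baire category and an identity-principle hypothesis, so that the global half of the
transport is a theorem modulo named inputs rather than a bare node.  Deliberately NOT here: K-secants, pure spinors,
Orlov's equivalence, the sheaves `ℰ`, `Ē`, `B` themselves ([M] §§2–9), and anything about CM POINTS of 𝔐 — the
CM-point / `HC_CM` interface is `Markman2025/CMPointTransport.lean`.

## References (pages = arXiv running heads; statement-by-statement table in the cell's NUMBERING.md)
* [S] arXiv:2509.23403v2, key `Markman2025SurveySecant`: Q 1.1 (p. 2), Thm 1.2, Cor 1.3 (p. 3), Thm 2.1 (pp. 6–7),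
  §4 (p. 9), Lemma 7.4 (p. 13), Cor 9.2 (p. 16), Lemma 11.3, Q 11.4, Prop 11.5 (p. 20), §11.5 (p. 21), §12 (p. 21).
* [M] arXiv:2502.03415v2, key `Markman2025SecantWeil`: Cor 1.3.2 (p. 6), Thm 1.4.1 (pp. 7–8), Thm 1.5.1, Cor 1.6.1
  (p. 9), Conj 7.3.9 (p. 44), §7.4.2 (p. 47), Lemma 8.3.4 (p. 59), Lemma 8.3.10 (p. 62), Lemma 9.3.11 + proof of 1.5.1 (p. 88).
* R.-O. Buchweitz, H. Flenner, Compositio Math. 137 (2003) 135–210, key `BuchweitzFlenner2003`.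
-/

namespace Literature.AlgebraicGeometry.Markman2025

open _root_.Topology

universe u
/-! ## The carrier: one connected component of Weil-type moduli, with the predicates of [S] §§2, 4, 11 -/

/-- An abstract CONNECTED COMPONENT 𝔐 of the moduli space of polarized abelian `2n`-folds of Weil type
`(A, η′, h′)` deformation equivalent to an anchor `x₀ = (X × X̂, η, h)` ([S] §4 p. 9: "all abelian varieties of
Weil type in the same connected component in moduli"; its period domain is "the adjoint orbit of the complex
structure of `X × X̂` in `Spin(V_ℝ)_P`", [M] p. 6, Lemma 4.0.2/Cor 4.0.4; [S] Lemma 7.4 p. 13), together with the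
objects the printed argument transports and the predicates it manipulates, all OPAQUE:
* `Pt`, its topology, `anchor` — the members `t ↦ (A_t, η_t, h_t)` and `x₀`;
* component-level invariants, constant along 𝔐 and fixed in [S] §1 / [M] §1.1 (pp. 2–3): `n` (dim `A_t = 2n`),
  `KImQuad` ([S] Thm 1.2 p. 3: "with complex multiplication by a quadratic imaginary number field `K`"), `Split`
  ([S] p. 3, chunk p0003: "`(A,η,h)` is said to be of split Weil type, if `H` has an isotropic subspace of half the
  dimension."), `DiscSignCoset` ([S] §11.5 p. 21, chunk p0019: "The discriminant takes values in `ℚ^×/Nm_{K/ℚ}(K^×)`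
  and is the coset of `(−1)ⁿ` if and only if the component parametrizes polarized abelian varieties of split Weil
  type [DM, Cor. 4.2].");
* `Obj` — coherent (possibly `μ_r`-twisted) sheaves / objects of `D^b` on the anchor variety or its isogenous
  quotient `(X × X̂)/Ḡ` ([S] §11.4), with `rank`;
* per-object predicates: `Semiregular E` ([S] §2 p. 6: "The sheaf `E` is semi-regular, if `σ_E` is injective."),
  `KerEvEqAnn E` ("the kernel of
  `ev_E : HH²(Y) → Hom(E,E[2])` is equal to the annihilator of `ch(E)`", [S] Lemma 11.3), `EvSurjective E`,
  `WeakCriterion E` ("`σ_E` restricts to the image of `ev_E` as an injective map", [S] Question 11.4),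
  `SecantSquare E` ("a `P`-secant `⊠²`-object `E := Φ(F₁ ⊠ F₂^∨)`", [M] Cor 1.3.2 p. 6), `KappaOffSym E` ([S] §4
  (2)(c) p. 9: "The class `κ_{d/2}(E)` in `H^{d/2,d/2}(X × X̂, ℚ)` does not belong to the image of `Sym^{d/2}(𝒜²)`.");
* per-(object, member) predicates: `KappaHodgeAt E t` / `KappaAlgAt E t` — the flat transport of
  `κ(E) := ch(E)·exp(−c₁(E)/r)` to `A_t` is of Hodge type / is algebraic ([S] p. 7);
* `WeilAlgAt t` — the answer YES, at the member `t`, to [S] Question 1.1 p. 2 ("Does `HW(A,η)` consist of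
  algebraic classes?").
Real-carrier counterparts in the tree: `Motives.HodgeStructure.EndAction.IsOfWeilType`, `Motives.weilDiscriminant`,
`Motives.IsHyperbolicWeilType` (split), `HodgeTheory.weilClassesOf`, `HodgeTheory.AbelianFamily`.
[cite: Markman2025SurveySecant, §4 p. 9 and §2 pp. 6-7 (transcription of an unrefereed preprint; abstract carrier)] -/
structure WeilComponent where
  /-- The members of the component. -/ Pt : Type u
  /-- Its (classical) topology. -/ topPt : TopologicalSpace Pt
  /-- The anchor `x₀ = (X × X̂, η, h)`. -/ anchor : Pt
  /-- Half the dimension: `dim A_t = 2n`. -/ n : ℕ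
  /-- `K` is an imaginary quadratic field `ℚ(√−d)` (`e = [K:ℚ] = 2`). -/ KImQuad : Prop
  /-- Split type: the `K`-Hermitian form has an isotropic subspace of half the dimension. -/ Split : Prop
  /-- The discriminant is the coset of `(−1)ⁿ` in `ℚ^×/Nm(K^×)`. -/ DiscSignCoset : Prop
  /-- Objects transported from the anchor. -/ Obj : Type u
  /-- Rank. -/ rank : Obj → ℤ
  /-- `σ_E` is injective. -/ Semiregular : Obj → Prop
  /-- `ker ev_E = Ann ch(E)` in `HH²`. -/ KerEvEqAnn : Obj → Prop
  /-- `ev_E : HH² → Ext²(E,E)` is surjective. -/ EvSurjective : Obj → Prop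
  /-- `σ_E` is injective on `Im ev_E` (the weak criterion of Question 11.4). -/ WeakCriterion : Obj → Prop
  /-- `E = Φ(F₁ ⊠ F₂^∨)` for `P`-secant objects `F₁, F₂`. -/ SecantSquare : Obj → Prop
  /-- Condition (2)(c) of [S] §4. -/ KappaOffSym : Obj → Prop
  /-- The flat transport of `κ(E)` to `A_t` is of Hodge type. -/ KappaHodgeAt : Obj → Pt → Prop
  /-- The flat transport of `κ(E)` to `A_t` is algebraic. -/ KappaAlgAt : Obj → Pt → Prop
  /-- Every class of `HW(A_t, η_t)` is algebraic. -/ WeilAlgAt : Pt → Prop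

attribute [instance] WeilComponent.topPt

variable (S : WeilComponent.{u})
/-! ## The nodes (named hypothesis `Prop`s, printed quantifier shapes) -/

/-- **[S] Question 1.1 (p. 2), on the component 𝔐**: "Does `HW(A,η)` consist of algebraic classes?" — for every
member.  This is the CONCLUSION shape of [S] Thm 1.2 on 𝔐 and of the strategy of §4.  Unrefereed preprint
(arXiv:2509.23403, 2025); an open question, not a claim.  Locator: chunk p0002.
[cite: Markman2025SurveySecant, Question 1.1 p. 2 (transcription; open question)] -/
def WeilClassesAlgebraicOn : Prop := ∀ t : S.Pt, S.WeilAlgAt t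

/-- **[S] Theorem 2.1 (Buchweitz–Flenner), AS APPLIED in [S] §2 pp. 6–7 and §4 to the Weil-type family over 𝔐.**
Printed (p. 6, chunk p0006): "Theorem 2.1. [BF1, Th. 1.5] Let `E` be a semi-regular coherent sheaf over `Y₀`, such
that `ch(E)` remains of Hodge type over `B`. Then `E` extends to a coherent sheaf over `π⁻¹(U)` for some open analytic
neighborhood `U` of `0` in `B`." and (p. 7, rank `r ≠ 0`): "The tensor product of a semi-regular sheaf with a
line-bundle is semi-regular and so Theorem 2.1 applies to `E ⊗ L⁻¹` to conclude that `κ(E)` remains algebraic in every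
fiber of `π`. The above conclusion remains valid even if `c₁(E)/r` is not integral." (via a rank-1 twisted sheaf; for
twisted sheaves this is [M] Conj 7.3.9 p. 44, verified for families of abelian varieties in [M] §7.4.2 p. 47).  Node
shape: semiregular + `κ(E)` of Hodge type along 𝔐 ⇒ `κ(E)` algebraic on an open neighbourhood of the anchor.  [S] v2
p. 6 cites "[BF1, Th. 1.5]" where [M] p. 8 cites "[BF1, Th. 5.1]" — see DIVERGENCE.  Real-carrier renderings:
`HodgeTheory.BuchweitzFlenner2003_variationalHodge_semiregular`, `HodgeTheory.Perry2026_semiregularTwisted_remainsAlgebraic`.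
Unrefereed use of a refereed theorem. [cite: Markman2025SurveySecant, Thm 2.1 pp. 6-7 (hypothesis schema; transcription)] -/
def SemiregularityTransportLocal : Prop :=
  ∀ E : S.Obj, S.rank E ≠ 0 → S.Semiregular E → (∀ t, S.KappaHodgeAt E t) →
    ∃ U : Set S.Pt, IsOpen U ∧ S.anchor ∈ U ∧ ∀ t ∈ U, S.KappaAlgAt E t

/-- **The "[Vo, Sec. 4.2]" spreading step** ([S] p. 6, chunk p0006: "Assume instead that the base `B` is a smooth and
connected analytic space and the fibers of `π` are projective. The theorem then implies that each class `ch_p(E)`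
remains algebraic over the whole of `B`, since the locus where it is algebraic is a countable union of Zariski closed
analytic subsets [Vo, Sec. 4.2], and it contains the non-empty open subset `U` over which `E` deforms."; [M] proof of
Thm 1.5.1 p. 88, chunk p0074: "The locus in moduli where the Hodge-Weil classes are algebraic is a countable union of
closed algebraic susbsets [Vo, Sec. 4.2]. Hence, the locus contains the whole irreducible component of moduli of
deformations of `(X × X̂, η, h)`." [sic]).  Node shape on 𝔐 (connected): algebraic on a non-empty open subset ⇒
algebraic at every member.  DERIVED below (`locus_eq_univ_of_baire`) from Baire category + an identity principle;
real-carrier renderings: `HodgeTheory.voisin2007_algebraicityLocus_iUnion_qbarClosed`,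
`HodgeTheory.charlesSchnell_algebraicityLocus_iUnion_closed` (file `AlgebraicityLocus.lean`), and the summit-side
global half `Summits/…/Theorems/WeilTypeLadderLocalAnchor.lean`.  Unrefereed preprint (arXiv:2509.23403, 2025).
[cite: Markman2025SurveySecant, §2 p. 6 (hypothesis schema; transcription)] -/
def AlgebraicLocusSpreads : Prop :=
  ∀ E : S.Obj, ∀ U : Set S.Pt, IsOpen U → U.Nonempty → (∀ t ∈ U, S.KappaAlgAt E t) → ∀ t, S.KappaAlgAt E t

/-- **[M] Corollary 1.3.2 (p. 6) = [S] Corollary 9.2 (p. 16) + Prop 7.3 / Lemma 7.4(2) (pp. 13–14).**  Printed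
([M]): "If the rank `r` of a `P`-secant `⊠²`-object `E := Φ(F₁ ⊠ F₂^∨)` is non zero, then its characteristic class
`κ(E)` is `Spin(V)_P`-invariant with respect to the representation `ρ`. Consequently, `κ(E)` remains of Hodge-type,
under every deformations of `(X × X̂, η, h)` as a polarized abelian variety of Weil-type." ([M] chunk p0005).  This is
the source of condition (2)(b) of [S] §4 ([M] Thm 1.4.1(3) for `ℰ`).  Unrefereed preprint (arXiv:2502.03415, 2025).
[cite: Markman2025SecantWeil, Cor. 1.3.2 p. 6 (hypothesis schema; transcription)] -/
def SecantKappaRemainsHodge : Prop :=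
  ∀ E : S.Obj, S.SecantSquare E → S.rank E ≠ 0 → ∀ t, S.KappaHodgeAt E t

/-- **[S] Lemma 11.3 (p. 20; "[M2, Lem. 8.3.10]"; cf. [M] Lemma 8.3.4 p. 59).**  Printed: "If the kernel of
`ev_E : HH²(Y) → Hom(E,E[2])` is equal to the annihilator of `ch(E)` in `HH²(Y)` and `ev_E` is surjective, then `E`
is semi-regular." (p. 19: "which we state for `Y` an abelian variety for simplicity"; [M] Lemma 8.3.10 p. 62
transports the first hypothesis along a derived equivalence `Φ : D^b(A) → D^b(B)`).  The linear algebra is PROVED on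
real carriers in the tree: `HodgeTheory.semiregular_of_ker_eq_of_surjective` (file `SemiregularityWeakCriterion.lean`).
Unrefereed preprint (arXiv:2509.23403, 2025); chunk p0019.
[cite: Markman2025SurveySecant, Lemma 11.3 p. 20 (hypothesis schema; transcription)] -/
def SemiregularityCriterion : Prop :=
  ∀ E : S.Obj, S.KerEvEqAnn E → S.EvSurjective E → S.Semiregular E

/-- **[S] Question 11.4 (p. 20) — an OPEN QUESTION, typed; used only as an explicit hypothesis of the conditional
edge `weilClassesAlgebraicOn_of_question114`, asserted nowhere.**  Printed:
"Is the surjectivity of `ev_E` needed in Lemma 11.3? Does the Semi-regularity Theorem 2.1 hold under the weaker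
assumption that `σ_E` restricts to the image of `ev_E` as an injective map (considering also twisted sheaves as we did
in Section 2)?"  Typed as the second (operative) question on 𝔐: the weak criterion in place of semiregularity in
`SemiregularityTransportLocal`.  [S] §12 p. 21: "We expect that an affirmative answer to Question 11.4 would lead to a
proof of the algebraicity of Weil classes on some higher dimensional abelian varieties, as well as for CM-fields `K`
with `[K:ℚ] > 2`".  Tree bearing on it (internal, kernel-checked, NOT literature): the weak criterion's linear algebra
`HodgeTheory.injOn_range_iff_weakCriterion`, and a negative instance on an abelian threefold, namespace
`HodgeTheory.WeakCriterionAbelianCounterexample`.  Unrefereed preprint (arXiv:2509.23403, 2025); chunk p0019.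
[cite: Markman2025SurveySecant, Question 11.4 p. 20 (open question; not asserted)] -/
def Question114 : Prop :=
  ∀ E : S.Obj, S.rank E ≠ 0 → S.WeakCriterion E → (∀ t, S.KappaHodgeAt E t) →
    ∃ U : Set S.Pt, IsOpen U ∧ S.anchor ∈ U ∧ ∀ t ∈ U, S.KappaAlgAt E t

/-- **[S] §4 (pp. 9–10), the second deduction — from `κ(E)` algebraic along 𝔐 and condition (2)(c) to the Weil
classes.**  Printed (p. 10, chunk p0009): "It follows that `κ_{d/2}(E)` belongs to the subspace `Im[Sym^{d/2}(𝒜²)] ⊕ HW(X × X̂, η)`, since these are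
the Hodge classes that remain of Hodge type on the generic abelian variety of Weil type … It follows that
`γ := κ_{d/2}(E) − δ` is a non-zero class in `HW(X × X̂, η)`, for some `δ ∈ Im[Sym^{d/2}(𝒜²)]`, by Condition (2c).
The class `γ` remains algebraic on every `(A,η′,h′)` deformation equivalent to `(X × X̂, η, h)`, since `κ_{d/2}(E)`
and `δ` do. Now `K` acts on `H^*(A,ℚ)` via algebraic correspondences and `HW(A,η′)` is `1`-dimensional over `K`.
Hence every class in `HW(A,η′)` is algebraic."  ([M] p. 88 uses Thm 1.4.1(4) in the same role.)  Node shape: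
(2)(c) + `κ(E)` algebraic at every member ⇒ Weil classes algebraic at every member.  Unrefereed preprint
(arXiv:2509.23403, 2025). [cite: Markman2025SurveySecant, §4 pp. 9-10 (hypothesis schema; transcription)] -/
def WeilClassesFromKappa : Prop :=
  ∀ E : S.Obj, S.rank E ≠ 0 → S.KappaOffSym E → (∀ t, S.KappaAlgAt E t) → ∀ t, S.WeilAlgAt t

/-- **[S] §4 (p. 9), the data the strategy asks for**, for one object `E` on the anchor: "(2) Construct a coherent
sheaf `E` over `X × X̂` of non-zero rank `r` satisfying: (a) `E` is semi-regular. (b) The class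
`κ(E) := ch(E)exp(−c₁(E)/r)` remains of Hodge type under all deformations of `(X × X̂, η, h)` as a polarized abelian
variety of Weil type. (c) The class `κ_{d/2}(E)` in `H^{d/2,d/2}(X × X̂, ℚ)` does not belong to the image of
`Sym^{d/2}(𝒜²)`."  (Condition (1), the construction of `η` and `h` with `V_σ` maximal isotropic, is what makes `x₀` a
point of 𝔐 and is absorbed in the carrier.)  Unrefereed preprint (arXiv:2509.23403, 2025); chunk p0009.
[cite: Markman2025SurveySecant, §4 p. 9 (hypothesis schema; transcription)] -/
def StrategyData (E : S.Obj) : Prop :=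
  S.rank E ≠ 0 ∧ S.Semiregular E ∧ (∀ t, S.KappaHodgeAt E t) ∧ S.KappaOffSym E

/-! ## Bookkeeping edges of [S] §4, PROVED -/

/-- **[S] §4 p. 9, first deduction**: "Conditions (2a) and (2b) and the Semi-regularity theorem imply that
`κ(E)` remains algebraic on every polarized abelian variety of Weil type `(A,η′,h′)` in the connected component of
moduli containing `(X × X̂, η, h)`."  Over the nodes this is: local transport at the anchor, then spreading.
[cite: Markman2025SurveySecant, §4 p. 9 (bookkeeping edge; transcription)] -/
theorem kappaAlg_everywhere (hBF : SemiregularityTransportLocal S) (hVo : AlgebraicLocusSpreads S)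
    {E : S.Obj} (hr : S.rank E ≠ 0) (ha : S.Semiregular E) (hb : ∀ t, S.KappaHodgeAt E t) :
    ∀ t, S.KappaAlgAt E t := by
  obtain ⟨U, hU, hx, hUalg⟩ := hBF E hr ha hb
  exact hVo E U hU ⟨S.anchor, hx⟩ hUalg

/-- **[S] §4 p. 9, the whole strategy on one component**: data (2)(a)(b)(c) for some `E` on the anchor, the
Semi-regularity theorem, the [Vo, Sec. 4.2] spreading and the second deduction give `HW(A_t,η_t)` algebraic for EVERY
member `t` of 𝔐 — i.e. [S] Question 1.1 on 𝔐.  The kernel checks that the four printed nodes compose as printed and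
that nothing else is used. [cite: Markman2025SurveySecant, §4 p. 9 (bookkeeping edge; transcription)] -/
theorem weilClassesAlgebraicOn_of_strategy (hBF : SemiregularityTransportLocal S) (hVo : AlgebraicLocusSpreads S)
    (hHW : WeilClassesFromKappa S) {E : S.Obj} (hE : StrategyData S E) : WeilClassesAlgebraicOn S :=
  fun t => hHW E hE.1 hE.2.2.2 (kappaAlg_everywhere S hBF hVo hE.1 hE.2.1 hE.2.2.1) t

/-- **Condition (2)(b) from the secant construction** ([M] Cor 1.3.2 p. 6 / Thm 1.4.1(3) p. 7): for a secant
`⊠²`-object of non-zero rank, (2)(b) is automatic, so the strategy data reduce to (a) and (c).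
[cite: Markman2025SecantWeil, Cor. 1.3.2 p. 6 (bookkeeping edge; transcription)] -/
theorem strategyData_of_secant (h132 : SecantKappaRemainsHodge S) {E : S.Obj} (hsec : S.SecantSquare E)
    (hr : S.rank E ≠ 0) (ha : S.Semiregular E) (hc : S.KappaOffSym E) : StrategyData S E :=
  ⟨hr, ha, h132 E hsec hr, hc⟩

/-- **[S] §11 as printed (pp. 18–21): the sixfold case assembled.**  With `Ē` the `Ḡ`-descended secant sheaf on
`A = (X × X̂)/Ḡ` ([S] §11.4; [M] §1.5 uses instead the `μ_{8d}`-twisted reflexive sheaf `B` on `Y`, Lemma 9.3.11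
p. 88 "The twisted reflexive sheaf `B` is semiregular", with `κ(ℰ) = q^*κ(B)`): Prop 11.5 p. 20 ("The sheaf `Ē` over
`A` is semi-regular.") is obtained from Lemma 11.3, whose two hypotheses [S] verifies for `Ē` (p. 21, end of the
sketch of proof: "Hence, `Ē` is semi-regular, by Lemma 11.3."); (2)(b) is [M] Thm 1.4.1(3); (2)(c) is [M]
Thm 1.4.1(4) p. 7 ("The `η(K)`-translates of the graded summand `κ₃(ℰ)` of `κ(ℰ)` in `H^{3,3}(X × X̂, ℚ)`, together
with `h³`, span the 3-dimensional subspace `ℚh³ ⊕ HW_P`"); rank `8d ≠ 0` is Thm 1.4.1(2) ("a simple reflexive sheaf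
of rank `8d`").  Conclusion: Step 1 of §11.5 on the component of the anchor.  All leaves
are hypotheses; the theorem is the printed wiring. [cite: Markman2025SurveySecant, §11.4-11.5 pp. 20-21 (bookkeeping edge; transcription)] -/
theorem step1_on_component (h113 : SemiregularityCriterion S) (hBF : SemiregularityTransportLocal S)
    (hVo : AlgebraicLocusSpreads S) (hHW : WeilClassesFromKappa S) {Ebar : S.Obj}
    (hrank : S.rank Ebar ≠ 0) (hker : S.KerEvEqAnn Ebar) (hsurj : S.EvSurjective Ebar)
    (h141_3 : ∀ t, S.KappaHodgeAt Ebar t) (h141_4 : S.KappaOffSym Ebar) : WeilClassesAlgebraicOn S :=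
  weilClassesAlgebraicOn_of_strategy S hBF hVo hHW ⟨hrank, h113 Ebar hker hsurj, h141_3, h141_4⟩

/-- **Why [S] descends to `Ē` (p. 20)**: "The sheaf `ℰ` … cannot be semi-regular for all `q ≥ 4` … Fortunately,
`σ_ℰ` restricts as an injective map to `Ext²(ℰ,ℰ)^{Ḡ}`, which contains the image of `ev_ℰ`. Descending to the
quotient abelian variety `A := (X × X̂)/Ḡ` enables us to use the semi-regularity theorem and avoid Question 11.4."
Bookkeeping: IF Question 11.4 had an affirmative answer on 𝔐, the weak criterion for `ℰ` itself would already run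
the strategy (no descent).  Recorded to make the dependence on the OPEN question explicit; nothing asserts it.
[cite: Markman2025SurveySecant, §11.4 p. 20 and §12 p. 21 (bookkeeping edge; transcription)] -/
theorem weilClassesAlgebraicOn_of_question114 (hQ : Question114 S) (hVo : AlgebraicLocusSpreads S)
    (hHW : WeilClassesFromKappa S) {E : S.Obj} (hr : S.rank E ≠ 0) (hweak : S.WeakCriterion E)
    (hb : ∀ t, S.KappaHodgeAt E t) (hc : S.KappaOffSym E) : WeilClassesAlgebraicOn S := by
  obtain ⟨U, hU, hx, hUalg⟩ := hQ E hr hweak hb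
  exact fun t => hHW E hr hc (hVo E U hU ⟨S.anchor, hx⟩ hUalg) t

/-! ## The spreading step is Baire category plus an identity principle (pure topology, PROVED) -/

/-- **The topology inside "[voisin]" ([S] p. 6) / "[Vo, Sec. 4.2]" ([M] p. 88).**  In a Baire space, if a set `L`
is a countable union of closed sets `Z k` each of which is either all of the space or has empty interior (the
identity principle for proper closed analytic subsets of a CONNECTED complex manifold — the hypothesis `hrigid`), and
`L` contains a non-empty open set, then `L` is everything.  Proof: Baire category applied to the closed cover
`{Z k} ∪ {Uᶜ}`.  This is the precise sense in which `AlgebraicLocusSpreads` is "topology + [Vo, Sec. 4.2]"; the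
analytic input (the locus IS such a union: Cattani–Deligne–Kaplan / [Vo, Sec. 4.2]) stays a hypothesis — on real
carriers it is `HodgeTheory.charlesSchnell_algebraicityLocus_iUnion_closed`. [folklore] -/
theorem locus_eq_univ_of_baire {X : Type*} [TopologicalSpace X] [BaireSpace X] {L : Set X} {Z : ℕ → Set X}
    (hZ : ∀ k, IsClosed (Z k)) (hL : ⋃ k, Z k = L) (hrigid : ∀ k, (interior (Z k)).Nonempty → Z k = Set.univ)
    {U : Set X} (hU : IsOpen U) (hUne : U.Nonempty) (hUL : U ⊆ L) : L = Set.univ := by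
  classical
  subst hL
  let F : Option ℕ → Set X := fun o => o.elim Uᶜ Z
  have hF : ∀ o, IsClosed (F o) := by rintro (_ | k); exacts [hU.isClosed_compl, hZ k]
  have hcov : ⋃ o, F o = Set.univ := by
    refine Set.eq_univ_of_forall fun x => ?_
    by_cases hx : x ∈ U
    · obtain ⟨k, hk⟩ := Set.mem_iUnion.mp (hUL hx)
      exact Set.mem_iUnion.mpr ⟨some k, hk⟩
    · exact Set.mem_iUnion.mpr ⟨none, hx⟩
  obtain ⟨x, hxI, hxU⟩ := (dense_iUnion_interior_of_closed hF hcov).exists_mem_open hU hUne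
  obtain ⟨o, ho⟩ := Set.mem_iUnion.mp hxI
  cases o with
  | none => exact absurd hxU (interior_subset ho)
  | some k => rw [← Set.univ_subset_iff, ← hrigid k ⟨x, ho⟩]; exact Set.subset_iUnion Z k

/-- **`AlgebraicLocusSpreads` from its two printed inputs.**  If 𝔐 is a Baire space (a complex manifold is), and for
every object `E` the locus `{t | κ(E) algebraic at t}` is a countable union of closed subsets each of which is all of
𝔐 or has empty interior ("[voisin]" + irreducibility of the component), then the spreading node holds.  The two
inputs are hypotheses; the implication is proved. [folklore] -/
theorem algebraicLocusSpreads_of_countable_closed [BaireSpace S.Pt]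
    (hlocus : ∀ E : S.Obj, ∃ Z : ℕ → Set S.Pt, (∀ k, IsClosed (Z k)) ∧ (⋃ k, Z k) = {t | S.KappaAlgAt E t} ∧
      ∀ k, (interior (Z k)).Nonempty → Z k = Set.univ) :
    AlgebraicLocusSpreads S := by
  intro E U hU hUne hUalg t
  obtain ⟨Z, hZ, hL, hrigid⟩ := hlocus E
  have h := locus_eq_univ_of_baire hZ hL hrigid hU hUne (fun s hs => hUalg s hs)
  have ht : t ∈ ({t | S.KappaAlgAt E t} : Set S.Pt) := by rw [h]; trivial
  exact ht

/-! ## Component-level statements of [S] Thm 1.2 and §11.5, and their printed wiring -/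

/-- **[S] Theorem 1.2 (p. 3, chunk p0003), sixfold half, on a component.**  Printed: "Theorem 1.2. [M2, Theorem 1.5.1]
The Weil classes for abelian fourfolds of Weil type and abelian sixfolds of split Weil type with complex
multiplication by a quadratic imaginary number field `K` are algebraic."  Here: `K` imaginary quadratic, `n = 3`, split
component ⇒ every member's Weil classes algebraic.  [M] Thm 1.5.1 p. 9 (chunk p0007) prints the discriminant form:
"Let `d` be a positive integer. Set `K := ℚ(√−d)`. The Hodge-Weil classes of polarized abelian sixfolds of Weil type
with complex multiplication by `K` and with discriminant `−1` are algebraic." (split ⟺ disc `(−1)³` is Step 1 below).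
Real-carrier statement in the tree: `HodgeTheory.Markman2025_weilClasses_algebraic_hyperbolicSixfold` (split typed as
`Motives.IsHyperbolicWeilType`).  Unrefereed preprints (arXiv:2509.23403 / 2502.03415, 2025).
[cite: Markman2025SurveySecant, Thm 1.2 p. 3 (hypothesis schema on a component; transcription)] -/
def Thm12Sixfold : Prop := S.KImQuad → S.n = 3 → S.Split → WeilClassesAlgebraicOn S

/-- **[S] Theorem 1.2 (p. 3), fourfold half, on a component** — the "abelian fourfolds of Weil type" clause of the
statement quoted under `Thm12Sixfold` (every discriminant; [S] §11.5 p. 21 concludes: "Hence, the Weil classes are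
algebraic on every abelian fourfold.").  Real-carrier statement: `HodgeTheory.Markman2025_weilClasses_algebraic_abelianFourfold`;
the discriminant-1, generic-fourfold precursor is [J] Thm 1.5 (= Thm 13.4), p. 236 (JEMS 25 (2023), refereed;
numbered Thm 1.3 in the pre-v4 arXiv text 1805.11574).  Unrefereed preprint
(arXiv:2509.23403, 2025); chunk p0003. [cite: Markman2025SurveySecant, Thm 1.2 p. 3 (hypothesis schema on a component; transcription)] -/
def Thm12Fourfold : Prop := S.KImQuad → S.n = 2 → WeilClassesAlgebraicOn S

/-- **[S] §11.5 Step 1, the discriminant criterion (p. 21, chunk p0019)**: "The discriminant takes values in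
`ℚ^×/Nm_{K/ℚ}(K^×)` and is the coset of `(−1)ⁿ` if and only if the component parametrizes polarized abelian varieties
of split Weil type [DM, Cor. 4.2]."  A published criterion (Deligne–Milne, *Hodge cycles on abelian varieties*, LNM
900, Cor. 4.2; the tree's `Motives.WeilDiscriminantSplit` PROVES split ⇒ disc `(−1)ⁿ` on real carriers; cf.
`HodgeTheory.Markman2025_weilClasses_algebraic_abelianSixfold_split_iff`), typed here as Markman uses it; the
EQUIVALENCE is cited, not assumed definitional (split is NOT typed as "disc = −1").
[cite: Markman2025SurveySecant, §11.5 Step 1 p. 21 (hypothesis schema; transcription)] -/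
def SplitIffDiscSignCoset : Prop := S.KImQuad → (S.Split ↔ S.DiscSignCoset)

/-- **[S] §11.5 Step 1 wiring (p. 21), on one component**: the strategy run on the anchor's component
(`step1_on_component`) gives algebraicity on the discriminant-`(−1)³` components (p. 21: "Two connected components of
the moduli space of polarized abelian varieties of Weil type of dimension `2n`, the same imaginary quadratic number
field, and the same discriminant, parametrize isogenous abelian varieties [vG, Th. 5.2(3)]." — this isogeny transfer
between components of equal invariants is NOT typed on the abstract carrier, see DIVERGENCE),
and the Deligne–Milne criterion turns "disc `(−1)³`" into "split" on the SAME component.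
[cite: Markman2025SurveySecant, §11.5 Step 1 p. 21 (bookkeeping edge; transcription)] -/
theorem thm12Sixfold_of_disc (hdisc : SplitIffDiscSignCoset S)
    (hrun : S.KImQuad → S.n = 3 → S.DiscSignCoset → WeilClassesAlgebraicOn S) : Thm12Sixfold S :=
  fun hK hn hsplit => hrun hK hn ((hdisc hK).mp hsplit)

/-- **[S] §11.5 Step 2 (p. 21, chunk p0019), the Schoen product trick as a node between two components.**  Printed:
"Hence, for every polarized abelian fourfold `(A₁,η₁,h₁)` of Weil type, of arbitrary discriminant, there exists a
polarized abelian surface of Weil type `(A₂,η₂,h₂)`, such that the discriminant of their product polarized abelian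
sixfold of Weil type `(A₁ × A₂, η, π₁^*h₁ + π₂^*h₂)` is the coset of `−1`. The sixfold is hence of split type and so
its Weil classes are algebraic. It follows that the Weil classes of `(A₁,η₁,h₁)` are algebraic, by [S2, Prop. 10]."
Typed as a predicate on a PAIR of components (parameters, never `∀/∃` over all
abstract carriers): `S₆` is a Schoen partner of the `n = 2` component `S₄` — `K` imaginary quadratic, `n = 3`, split,
and algebraicity on `S₆` gives algebraicity on `S₄`.  Real-carrier version (proved modulo named facts):
`HodgeTheory.WeilClassesFourfoldsFromSixfolds` (`Markman2025_exists_weilTypeSurface_prod_isHyperbolicWeilType`,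
`Schoen1998_weilClasses_algebraic_of_prod_surface`).  Unrefereed preprint (arXiv:2509.23403, 2025).
[cite: Markman2025SurveySecant, §11.5 Step 2 p. 21 (hypothesis schema on a pair of components; transcription)] -/
def SchoenProductStep (S₄ S₆ : WeilComponent.{u}) : Prop :=
  S₆.KImQuad ∧ S₆.n = 3 ∧ S₆.Split ∧ (WeilClassesAlgebraicOn S₆ → WeilClassesAlgebraicOn S₄)

/-- **[S] Thm 1.2, fourfold half on `S₄`, from the sixfold half on a Schoen partner `S₆`** — the printed wiring of
§11.5 Step 2 (the `n = 2` invariants of `S₄` are not even consumed: the partner supplies everything).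
[cite: Markman2025SurveySecant, §11.5 Step 2 p. 21 (bookkeeping edge; transcription)] -/
theorem thm12Fourfold_of_sixfold (S₄ S₆ : WeilComponent.{u}) (hstep : SchoenProductStep S₄ S₆)
    (h6 : Thm12Sixfold S₆) : Thm12Fourfold S₄ :=
  fun _ _ => hstep.2.2.2 (h6 hstep.1 hstep.2.1 hstep.2.2.1)

/-- **[S] Corollary 1.3 (p. 3) from Thm 1.2 via the reduction Markman invokes — the DAG's top edge, whose
non-bookkeeping input is the tree's NAMED real-carrier fact
`HodgeTheory.MoonenZarhin1999_hodgeClasses_abelian_dim_le_five_of_weilClassesFourfolds` (Moonen–Zarhin; it is NOT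
re-vendored here).**  Printed ([S] p. 3, chunk p0004; "conj." abbreviates the printed word): "The Hodge conj. is known
for projective varieties of dimension `≤ 3`. The Hodge ring of abelian fourfolds is generated by divisor classes and
Weil classes for complex multiplication by possibly more than one imaginary quadratic number field, by work of Moonen
and Zarhin [MZ1, MZ2] combined with a result of Ramón Mari in the case of products of abelian surfaces [R]. The Hodge
ring for simple abelian varieties of prime dimension is generated by divisor classes, by a result of Tankeev [Ta]. If
`X` is a non-simple abelian variety of dimension 5, then the Hodge ring of `X` is generated by divisor classes and pull
backs of Weil classes from quotient abelian fourfolds, by [MZ2, Theorem 0.2]. Combining these results with Theorem 1.2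
we get: Corollary 1.3. The Hodge conj. holds for abelian varieties of dimension `≤ 5`."  ([M] Cor 1.6.1 p. 9, chunk
p0007, prints the fourfold case: "The Hodge conj. holds for abelian fourfolds.", inputs [S2, Prop. 10], [MZ1, Theorem
2.11], [R, Theorem 4.11], [MZ3].)  In the tree the reduction is PROVED modulo exactly two Moonen–Zarhin codimension-2
facts (`HodgeTheory.Markman2025_hodgeClasses_algebraic_abelian_dim_le_five_of_codimTwoFacts`), and the CONVERSE slice
Cor 1.3 ⇒ Thm 1.2 (fourfold half) is `HodgeTheory.Markman2025_weilClasses_algebraic_abelianFourfold_of_dim_le_five`.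
[cite: Markman2025SurveySecant, Cor. 1.3 p. 3 (bookkeeping edge; transcription)] -/
theorem cor13_of_thm12 (hred : HodgeTheory.MoonenZarhin1999_hodgeClasses_abelian_dim_le_five_of_weilClassesFourfolds)
    (h12 : HodgeTheory.Markman2025_weilClasses_algebraic_abelianFourfold) :
    HodgeTheory.Markman2025_hodgeClasses_algebraic_abelian_dim_le_five := hred h12

/-! ## Name checks: the real-carrier statements this architecture points to exist in the tree -/
example := And.intro @HodgeTheory.Markman2025_weilClasses_algebraic_abelianFourfold_of_dim_le_five
  @HodgeTheory.Markman2025_hodgeClasses_algebraic_abelian_dim_le_five_of_codimTwoFacts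
example : List Prop := [HodgeTheory.Markman2025_weilClasses_algebraic_hyperbolicSixfold,
  HodgeTheory.BuchweitzFlenner2003_variationalHodge_semiregular, HodgeTheory.Perry2026_semiregularTwisted_remainsAlgebraic,
  HodgeTheory.Markman2025_secantAnchor_locallyAlgebraic_sixfold, HodgeTheory.charlesSchnell_algebraicityLocus_iUnion_closed]

end Literature.AlgebraicGeometry.Markman2025
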